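import Summits.Ventures.PercRepro.S1TriangleKernelSevenLemmas

/-!
# PercRepro — THE TRIANGLE KERNEL AT NULLITY `7`, THE TWO CASES WITH AN INSIDE POINT (p8, gen 24; a feeder for S4 —
the rows `≤ 36` of the `q = 7` window)

`s₃ = 13` at nullity `7`, `m = 3` at `x`, `Q = U ∖ St`, and some `q₀ ∈ Q` lies in `cl(St)` (the other case, no point of
`Q` in `cl(St)`, is `false_of_forall_notMem_closure_star`). The outside points `O = U ∖ cl(St)` number `≥ 4`
(`four_le_ncard_sdiff_closure`), and `q₀ ∉ O`.
* `|U| = 12`, `r(U) = 5` (`false_of_twelve`): `|Q| = 5`, so `O = Q ∖ {q₀}` has `4` points. A triangle avoiding `x`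
  whose points of `Q` are all `q₀` is determined by its two star points (at most `3` such, disjoint pairs in the `6`
  star points off `x`); a triangle through an outside point contains a second outside point, so it contains one of the
  `C(4, 2) = 6` pairs of `O`, each in at most one triangle: `10 ≤ 3 + 6`, impossible.
* `|U| = 13`, `r(U) = 6` (`false_of_thirteen`): `|Q| = 6`, `|O| ≤ 5`. For `q₁ ∈ O`, the flat `F = cl(St ∪ {q₁})` has
  rank `≤ 5 < 6`, so `U ∖ F` has `≥ 4` points, all in `O ∖ {q₁}`: `O ∖ {q₁} = U ∖ F`. Every triangle through `q₁` has
  a second point in `O`, hence off `F`, and then its third point is off `F` too (else the second would be in `F`): the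
  three triangles through `q₁` carry three disjoint pairs of the `4`-point set `U ∖ F`, impossible.
Axioms: standard.
-/

open scoped Matroid

namespace PercRepro

namespace S1

open Set

variable {α : Type}

open Classical in
/-- **Two distinct points lie in at most one triangle** (finset form): the triangles of `𝒮` containing both points of a
two-element finset `P` number at most one. -/
theorem kernelSeven_card_filter_subset_le_one (M : Matroid α) [M.Finite]
    (hC1 : ∀ L ⊆ M.E, M.eRk L = 2 → L.ncard ≤ 3) (𝒮 : Finset (Set α))
    (h𝒮 : ∀ T ∈ 𝒮, T ∈ ThmN.triangles M) {P : Finset α} (hP : P.card = 2) :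
    (𝒮.filter (fun T => (↑P : Set α) ⊆ T)).card ≤ 1 := by
  obtain ⟨u, v, huv, hPuv⟩ := Finset.card_eq_two.1 hP
  rw [Finset.card_le_one]
  intro T hT T' hT'
  rw [Finset.mem_filter] at hT hT'
  by_contra hne
  have hu : u ∈ T ∩ T' := ⟨hT.2 (by rw [hPuv]; simp), hT'.2 (by rw [hPuv]; simp)⟩
  have hv : v ∈ T ∩ T' := ⟨hT.2 (by rw [hPuv]; simp), hT'.2 (by rw [hPuv]; simp)⟩
  exact huv (eq_of_mem_inter_of_mem_triangles M hC1 (h𝒮 T hT.1) (h𝒮 T' hT'.1) hne hu hv)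

/-- **CASE `|U| = 12` of the kernel at nullity `7`**: with the three triangles through `x` (all of them), every point of
`U` on `≥ 3` triangles, `10` triangles avoiding `x`, `|Q| = 5`, `r(U) = 5` and a point `q₀ ∈ Q ∩ cl(St)`, a
contradiction. -/
theorem false_of_twelve (M : Matroid α) [M.Finite]
    (hC1 : ∀ L ⊆ M.E, M.eRk L = 2 → L.ncard ≤ 3)
    (hC2 : ∀ X ⊆ M.E, M.eRk X ≤ 3 → X.ncard ≤ 6) {x : α} (hx : M.IsNonloop x)
    {Ci Cj Ck : Set α} (hCi : Ci ∈ ThmN.trianglesThrough M x) (hCj : Cj ∈ ThmN.trianglesThrough M x)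
    (hCk : Ck ∈ ThmN.trianglesThrough M x) (hij : Ci ≠ Cj) (hik : Ci ≠ Ck) (hjk : Cj ≠ Ck)
    (hmem3 : ∀ C, C ∈ ThmN.trianglesThrough M x → C = Ci ∨ C = Cj ∨ C = Ck)
    (hmin3 : ∀ y ∈ ⋃₀ ThmN.triangles M, 3 ≤ (ThmN.trianglesThrough M y).ncard)
    (hS₂card : {C | M.IsCircuit C ∧ C.ncard = 3 ∧ x ∉ C}.ncard = 10)
    (hQ5 : ((⋃₀ ThmN.triangles M) \ ({x} ∪ (Ci ∪ Cj ∪ Ck))).ncard = 5)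
    (hr5 : M.eRk (⋃₀ ThmN.triangles M) = 5) {q₀ : α}
    (hq₀Q : q₀ ∈ (⋃₀ ThmN.triangles M) \ ({x} ∪ (Ci ∪ Cj ∪ Ck)))
    (hq₀cl : q₀ ∈ M.closure ({x} ∪ (Ci ∪ Cj ∪ Ck))) : False := by
  classical
  set S := ThmN.triangles M with hS
  have hSfin : S.Finite :=
    M.ground_finite.finite_subsets.subset (fun C hC => hC.1.subset_ground)
  have hUE : ⋃₀ S ⊆ M.E := by
    intro z hz
    obtain ⟨C, hC, hzC⟩ := Set.mem_sUnion.1 hz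
    exact hC.1.subset_ground hzC
  have hUfin : (⋃₀ S).Finite := M.ground_finite.subset hUE
  have hxU' : x ∈ ⋃₀ S := Set.mem_sUnion.2 ⟨Ci, ⟨hCi.1, hCi.2.1⟩, hCi.2.2⟩
  set s : Finset (Set α) := {Ci, Cj, Ck} with hsdef
  have hs : ∀ C ∈ s, C ∈ ThmN.trianglesThrough M x := by
    intro C hC
    simp only [hsdef, Finset.mem_insert, Finset.mem_singleton] at hC
    rcases hC with rfl | rfl | rfl
    · exact hCi
    · exact hCj
    · exact hCk
  have hscard : s.card = 3 := Finset.card_eq_three.2 ⟨Ci, Cj, Ck, hij, hik, hjk, rfl⟩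
  obtain ⟨hstar_rk, hstar_card⟩ := ThmN.eRk_le_and_ncard_eq_of_triangles M hC1 hx s hs
  rw [hscard] at hstar_card hstar_rk
  set St := ({x} ∪ (Ci ∪ Cj ∪ Ck) : Set α) with hSt
  have hSteq : ({x} ∪ ⋃ C ∈ s, C) = St := by
    ext z
    constructor
    · intro hz
      rcases hz with hz | hz
      · exact Or.inl hz
      · obtain ⟨C, hC, hzC⟩ := Set.mem_iUnion₂.1 hz
        simp only [hsdef, Finset.mem_insert, Finset.mem_singleton] at hC
        rcases hC with rfl | rfl | rfl
        · exact Or.inr (Or.inl (Or.inl hzC))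
        · exact Or.inr (Or.inl (Or.inr hzC))
        · exact Or.inr (Or.inr hzC)
    · intro hz
      rcases hz with hz | hz
      · exact Or.inl hz
      · refine Or.inr ?_
        rcases hz with (hz | hz) | hz
        · exact Set.mem_iUnion₂.2 ⟨Ci, by simp [hsdef], hz⟩
        · exact Set.mem_iUnion₂.2 ⟨Cj, by simp [hsdef], hz⟩
        · exact Set.mem_iUnion₂.2 ⟨Ck, by simp [hsdef], hz⟩
  rw [hSteq] at hstar_card hstar_rk
  have hStU : St ⊆ ⋃₀ S := by
    intro z hz
    rcases hz with hz | hz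
    · rw [Set.mem_singleton_iff.1 hz]; exact hxU'
    · rcases hz with (hz | hz) | hz
      · exact Set.mem_sUnion.2 ⟨Ci, ⟨hCi.1, hCi.2.1⟩, hz⟩
      · exact Set.mem_sUnion.2 ⟨Cj, ⟨hCj.1, hCj.2.1⟩, hz⟩
      · exact Set.mem_sUnion.2 ⟨Ck, ⟨hCk.1, hCk.2.1⟩, hz⟩
  have hStE : St ⊆ M.E := hStU.trans hUE
  have hStfin : St.Finite := hUfin.subset hStU
  have hStcl' : St ⊆ M.closure St := M.subset_closure St hStE
  set Q := (⋃₀ S) \ St with hQ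
  have hQfin : Q.Finite := hUfin.subset Set.sdiff_subset
  have hTU : ∀ T ∈ S, T ⊆ ⋃₀ S := fun T hT z hz => Set.mem_sUnion.2 ⟨T, hT, hz⟩
  have hTx : ∀ {y : α}, y ∉ St → ∀ T ∈ ThmN.trianglesThrough M y, x ∉ T := by
    intro y hy T hT hxT
    apply hy
    rcases hmem3 T ⟨hT.1, hT.2.1, hxT⟩ with rfl | rfl | rfl
    · exact Or.inr (Or.inl (Or.inl hT.2.2))
    · exact Or.inr (Or.inl (Or.inr hT.2.2))
    · exact Or.inr (Or.inr hT.2.2)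
  set S₂ := {C | M.IsCircuit C ∧ C.ncard = 3 ∧ x ∉ C} with hS₂
  have hS₂fin : S₂.Finite := hSfin.subset (fun C hC => ⟨hC.1, hC.2.1⟩)
  have hS₂S : ∀ T ∈ S₂, T ∈ S := fun T hT => ⟨hT.1, hT.2.1⟩
  have hS₂x : ∀ T ∈ S₂, x ∉ T := fun T hT => hT.2.2
  have hQpt : ∀ T ∈ S₂, ∃ q ∈ T, q ∈ Q := by
    intro T hT
    obtain ⟨q, hqT, hqSt⟩ := exists_mem_notMem_star_of_notMem M hC1 hC2 hx hCi hCj hCk hij hik hjk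
      (hS₂S T hT) (hS₂x T hT)
    exact ⟨q, hqT, hTU T (hS₂S T hT) hqT, hqSt⟩
  set S₂f : Finset (Set α) := hS₂fin.toFinset with hS₂fdef
  have hmemS₂ : ∀ T, T ∈ S₂f ↔ T ∈ S₂ := fun T => Set.Finite.mem_toFinset hS₂fin
  have hS₂fcard : S₂f.card = 10 := by
    rw [hS₂fdef, ← Set.ncard_eq_toFinset_card _ hS₂fin, hS₂card]
  -- the outside points: `O = Q ∖ {q₀}`, four of them
  have hStcl : M.eRk (M.closure St) ≤ 4 := by
    rw [M.eRk_closure_eq]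
    have h4 : ((1 + 3 : ℕ) : ℕ∞) = 4 := by norm_num
    rw [h4] at hstar_rk
    exact hstar_rk
  have hexO : ∃ q ∈ ⋃₀ S, q ∉ M.closure St := by
    by_contra h
    push Not at h
    have hsub : ⋃₀ S ⊆ M.closure St := fun z hz => h z hz
    have h1 := M.eRk_mono hsub
    rw [hr5] at h1
    have h2 : (5 : ℕ∞) ≤ 4 := h1.trans hStcl
    have h3 : (5 : ℕ) ≤ 4 := by exact_mod_cast h2
    omega
  obtain ⟨q, hqU, hqcl⟩ := hexO
  set O := (⋃₀ S) \ M.closure St with hO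
  have hOQ : O ⊆ Q := fun z hz => ⟨hz.1, fun h => hz.2 (hStcl' h)⟩
  have hOfin : O.Finite := hUfin.subset Set.sdiff_subset
  have hO4 : 4 ≤ O.ncard := four_le_ncard_sdiff_closure M hC1 hqU hqcl (hmin3 q hqU)
  have hq₀O : q₀ ∉ O := fun h => h.2 hq₀cl
  have hOsub : O ⊆ Q \ {q₀} := fun z hz => ⟨hOQ hz, fun h => hq₀O (Set.mem_singleton_iff.1 h ▸ hz)⟩
  have hQq₀ : (Q \ {q₀}).ncard = 4 := by
    rw [Set.ncard_sdiff' (Set.singleton_subset_iff.2 hq₀Q) hQfin, hQ5, Set.ncard_singleton]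
  have hOeq : O = Q \ {q₀} :=
    Set.eq_of_subset_of_ncard_le hOsub (by rw [hQq₀]; exact hO4) (hQfin.subset Set.sdiff_subset)
  have hOcard : O.ncard = 4 := by rw [hOeq, hQq₀]
  have hQO : ∀ z ∈ Q, z ≠ q₀ → z ∈ O := by
    intro z hz hzq
    rw [hOeq]
    exact ⟨hz, fun h => hzq (Set.mem_singleton_iff.1 h)⟩
  -- the two families
  set 𝒜 := S₂f.filter (fun T => ∀ z ∈ T, z ∈ Q → z = q₀) with h𝒜
  set ℬ := S₂f.filter (fun T => ∃ z ∈ T, z ∈ O) with hℬ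
  have hcover : S₂f ⊆ 𝒜 ∪ ℬ := by
    intro T hT
    by_cases h : ∃ z ∈ T, z ∈ O
    · exact Finset.mem_union_right _ (Finset.mem_filter.2 ⟨hT, h⟩)
    · push Not at h
      refine Finset.mem_union_left _ (Finset.mem_filter.2 ⟨hT, fun z hz hzQ => ?_⟩)
      by_contra hzq
      exact h z hz (hQO z hzQ hzq)
  -- `|𝒜| ≤ 3`: the two star points of each member, disjoint pairs in the six star points off `x`
  have hAfin : (St \ {x}).Finite := hStfin.subset Set.sdiff_subset
  set Af : Finset α := hAfin.toFinset with hAfdef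
  have hmemA : ∀ a, a ∈ Af ↔ a ∈ St \ {x} := fun a => Set.Finite.mem_toFinset hAfin
  have hxSt : x ∈ St := Or.inl rfl
  have hAfcard : Af.card = 6 := by
    rw [hAfdef, ← Set.ncard_eq_toFinset_card _ hAfin,
      Set.ncard_sdiff' (Set.singleton_subset_iff.2 hxSt) hStfin, hstar_card, Set.ncard_singleton]
  have h𝒜q₀ : ∀ T ∈ 𝒜, q₀ ∈ T := by
    intro T hT
    rw [Finset.mem_filter, hmemS₂] at hT
    obtain ⟨q', hq'T, hq'Q⟩ := hQpt T hT.1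
    have := hT.2 q' hq'T hq'Q
    rw [← this]; exact hq'T
  have h𝒜star : ∀ T ∈ 𝒜, T \ {q₀} ⊆ St \ {x} := by
    intro T hT z hz
    have hT' := Finset.mem_filter.1 hT
    have hTS₂ : T ∈ S₂ := (hmemS₂ T).1 hT'.1
    have hzU : z ∈ ⋃₀ S := hTU T (hS₂S T hTS₂) hz.1
    refine ⟨?_, ?_⟩
    · by_contra hzSt
      have hzQ : z ∈ Q := ⟨hzU, hzSt⟩
      exact hz.2 (by rw [hT'.2 z hz.1 hzQ]; exact Set.mem_singleton q₀)
    · intro hzx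
      rw [Set.mem_singleton_iff.1 hzx] at hz
      exact hS₂x T hTS₂ hz.1
  have h𝒜two : ∀ T ∈ 𝒜, 2 ≤ (Af.filter (fun a => a ∈ T)).card := by
    intro T hT
    have hTS₂ : T ∈ S₂ := (hmemS₂ T).1 (Finset.mem_filter.1 hT).1
    have hTfin : T.Finite := M.ground_finite.subset hTS₂.1.subset_ground
    have hD : (T \ {q₀}).Finite := hTfin.subset Set.sdiff_subset
    have hDcard : (T \ {q₀}).ncard = 2 := by
      rw [Set.ncard_sdiff' (Set.singleton_subset_iff.2 (h𝒜q₀ T hT)) hTfin, hTS₂.2.1, Set.ncard_singleton]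
    have hsub : hD.toFinset ⊆ Af.filter (fun a => a ∈ T) := by
      intro z hz
      rw [Set.Finite.mem_toFinset] at hz
      rw [Finset.mem_filter, hmemA]
      exact ⟨h𝒜star T hT hz, hz.1⟩
    have := Finset.card_le_card hsub
    rw [← Set.ncard_eq_toFinset_card _ hD, hDcard] at this
    exact this
  have h𝒜disj : (↑𝒜 : Set (Set α)).PairwiseDisjoint (fun T => Af.filter (fun a => a ∈ T)) := by
    intro T hT T' hT' hne
    rw [Function.onFun, Finset.disjoint_left]
    intro a haT haT'
    rw [Finset.mem_filter, hmemA] at haT haT'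
    have hTS₂ : T ∈ S₂ := (hmemS₂ T).1 (Finset.mem_filter.1 (Finset.mem_coe.1 hT)).1
    have hT'S₂ : T' ∈ S₂ := (hmemS₂ T').1 (Finset.mem_filter.1 (Finset.mem_coe.1 hT')).1
    have hq₀T : q₀ ∈ T := h𝒜q₀ T (Finset.mem_coe.1 hT)
    have hq₀T' : q₀ ∈ T' := h𝒜q₀ T' (Finset.mem_coe.1 hT')
    have haq₀ : a ≠ q₀ := fun h => hq₀Q.2 (h ▸ haT.1.1)
    exact haq₀ (eq_of_mem_inter_of_mem_triangles M hC1 (hS₂S T hTS₂) (hS₂S T' hT'S₂) hne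
      ⟨haT.2, haT'.2⟩ ⟨hq₀T, hq₀T'⟩)
  have h𝒜card : 𝒜.card ≤ 3 := by
    have hbiU : 𝒜.biUnion (fun T => Af.filter (fun a => a ∈ T)) ⊆ Af := by
      intro a ha
      obtain ⟨T, -, haT⟩ := Finset.mem_biUnion.1 ha
      exact (Finset.mem_filter.1 haT).1
    have h1 := Finset.card_le_card hbiU
    rw [Finset.card_biUnion h𝒜disj, hAfcard] at h1
    have h2 : ∑ _T ∈ 𝒜, 2 ≤ ∑ T ∈ 𝒜, (Af.filter (fun a => a ∈ T)).card := Finset.sum_le_sum h𝒜two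
    rw [Finset.sum_const, smul_eq_mul] at h2
    omega
  -- `|ℬ| ≤ 6`: every member contains a pair of outside points, each pair in at most one triangle
  set Of : Finset α := hOfin.toFinset with hOfdef
  have hmemO : ∀ z, z ∈ Of ↔ z ∈ O := fun z => Set.Finite.mem_toFinset hOfin
  have hOfcard : Of.card = 4 := by rw [hOfdef, ← Set.ncard_eq_toFinset_card _ hOfin, hOcard]
  have hℬcover : ℬ ⊆ (Of.powersetCard 2).biUnion (fun P => S₂f.filter (fun T => (↑P : Set α) ⊆ T)) := by
    intro T hT
    obtain ⟨hTS₂f, z, hzT, hzO⟩ := Finset.mem_filter.1 hT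
    have hTS₂ : T ∈ S₂ := (hmemS₂ T).1 hTS₂f
    have hTz : T ∈ ThmN.trianglesThrough M z := ⟨hTS₂.1, hTS₂.2.1, hzT⟩
    obtain ⟨y, hyT, hyz, hycl⟩ := exists_mem_notMem_closure_of_notMem_closure M hzO.2 hTz
    have hyO : y ∈ O := ⟨hTU T (hS₂S T hTS₂) hyT, hycl⟩
    refine Finset.mem_biUnion.2 ⟨{z, y}, ?_, ?_⟩
    · rw [Finset.mem_powersetCard]
      refine ⟨?_, Finset.card_pair hyz.symm⟩
      intro w hw
      simp only [Finset.mem_insert, Finset.mem_singleton] at hw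
      rcases hw with rfl | rfl
      · exact (hmemO w).2 hzO
      · exact (hmemO w).2 hyO
    · rw [Finset.mem_filter]
      refine ⟨hTS₂f, ?_⟩
      intro w hw
      simp only [Finset.coe_insert, Finset.coe_singleton, Set.mem_insert_iff, Set.mem_singleton_iff] at hw
      rcases hw with rfl | rfl
      · exact hzT
      · exact hyT
  have hℬcard : ℬ.card ≤ 6 := by
    calc ℬ.card ≤ ((Of.powersetCard 2).biUnion (fun P => S₂f.filter (fun T => (↑P : Set α) ⊆ T))).card :=
          Finset.card_le_card hℬcover
      _ ≤ ∑ P ∈ Of.powersetCard 2, (S₂f.filter (fun T => (↑P : Set α) ⊆ T)).card := Finset.card_biUnion_le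
      _ ≤ ∑ _P ∈ Of.powersetCard 2, 1 := by
          refine Finset.sum_le_sum ?_
          intro P hP
          exact kernelSeven_card_filter_subset_le_one M hC1 S₂f (fun T hT => hS₂S T ((hmemS₂ T).1 hT))
            (Finset.mem_powersetCard.1 hP).2
      _ = 6 := by rw [Finset.sum_const, smul_eq_mul, Finset.card_powersetCard, hOfcard]; rfl
  have := Finset.card_le_card hcover
  have := Finset.card_union_le 𝒜 ℬ
  omega

end S1

end PercRepro
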